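import Literature.Analysis.FluidPDE.ExtremeGrowthBounds
import Literature.Analysis.FluidPDE.NSCoriolisTorus
import Literature.Analysis.FluidPDE.DuchonRobertLionsCounterexample
import Literature.Analysis.FunctionSpaces.TorusClassicalNSUniqueness
import HarnessLib

/-!
# Functional mining: invariant regions of gauges along Navier–Stokes (template; the Lu–Doering small-data region)

Search for candidate a priori estimates; no regularity claim.

Cell `pub-nsfunc` (host summit NavierStokesRegularity, topic `FunctionalMining`). Scale-invariant
(dimensionless) functionals escape the space-time scaling sieve but not the parity sieve: they are
not monotone; the right census shape for them is a THRESHOLD / INVARIANT-REGION statement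
"`R(ν, u(a))` ⇒ `R(ν, u(t))` for all later `t`" (paper `estimates.tex`, D10; DERIVATIVES §3 (2c)).
This file fixes that third template next to the rate and sup templates of
`FunctionalMining/RateBudgets.lean`, with a positive control and the one such region in print:

* `IsInvariantRegion R` — along every zero-mean classical solution of the unforced system on
  `T³ × [a, b]`, if the initial field satisfies `R ν (u a)` then every later slice does;
  `IsInvariantRegion.and` (intersections);
* `kineticEnergy_sublevel_isInvariantRegion` — POSITIVE CONTROL: the sublevel sets
  `{K ≤ c}` of the kinetic energy (energy balance, `dK/dt = −ν‖∇u‖² ≤ 0`);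
* `luDoering_smallData_isInvariantRegion` — the LU–DOERING SMALL-DATA REGION
  `{(27/(2πν)⁴) K ℰ < 1}` (`K = ½‖u‖₂²`, `ℰ = ½‖∇u‖₂² = torusEnstrophy`; the constant is
  `C_LD(ν)/(2ν)`, `luDoeringConst_div_two_nu`) is forward-invariant, CONDITIONAL on the tree's
  named fact `LuDoering2008_enstrophyRate_le` (Lu–Doering 2008; Ayala–Protas 2017 (2.10)–(2.12)):
  from the tree's `inv_torusEnstrophy_sub_inv_le`, `1/ℰ(a) − 1/ℰ(t) ≤ c(K(a) − K(t))`, the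
  quantity `1/ℰ − cK` is non-decreasing, so `cKℰ < 1` persists while `ℰ > 0`; if `ℰ` vanishes
  at some time the zero-mean slice is the rest state (Poincaré,
  `Torus.integral_norm_sq_le_gradNormSq_of_hasZeroMean`) and stays so by forward uniqueness
  (`Torus.IsClassicalNSSolutionOn.velocity_unique_of_mem` against the steady solution
  `isClassicalNSSolutionOn_const ν 0`), where `cKℰ = 0 < 1`. The census must never see a bank
  trajectory leave this region (a calibration row: a violation is a bug, not a finding).

Deliberately NOT here: any unconditional invariant region beyond the energy; regions for other
gauges (census rows to come).
-/

noncomputable section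

open MeasureTheory Set Filter
open scoped Topology InnerProductSpace RealInnerProductSpace

namespace Summit.NavierStokesRegularity.FunctionalMining

open Literature.Analysis.FunctionSpaces Literature.Analysis.FluidPDE

variable {d : Type*} [Fintype d] [DecidableEq d]

/-! ## The template -/

/-- **Invariant region along Navier–Stokes (census template, threshold form).** For a region
`R ν v` of velocity fields (typically a strict sublevel set of a dimensionless gauge): on the
3-torus, for every `ν > 0`, `a < b`, every zero-mean classical solution `(u, p)` of unforced
Navier–Stokes on `T³ × [a, b]`: if `R ν (u a)` then `R ν (u t)` for every `t ∈ [a, b]`. -/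
def IsInvariantRegion (R : ℝ → (UnitAddTorus d → EuclideanSpace ℝ d) → Prop) : Prop :=
  Fintype.card d = 3 → ∀ ⦃ν : ℝ⦄, 0 < ν → ∀ ⦃a b : ℝ⦄, a < b →
    ∀ ⦃u : ℝ → UnitAddTorus d → EuclideanSpace ℝ d⦄ ⦃p : ℝ → UnitAddTorus d → ℝ⦄,
      Torus.IsClassicalNSSolutionOn (Icc a b) ν 0 u p →
      (∀ t ∈ Icc a b, Torus.HasZeroMean (u t)) →
      R ν (u a) → ∀ t ∈ Icc a b, R ν (u t)

/-- Intersections of invariant regions are invariant. [folklore] -/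
theorem IsInvariantRegion.and {R₁ R₂ : ℝ → (UnitAddTorus d → EuclideanSpace ℝ d) → Prop}
    (h₁ : IsInvariantRegion R₁) (h₂ : IsInvariantRegion R₂) :
    IsInvariantRegion (fun ν v => R₁ ν v ∧ R₂ ν v) :=
  fun hd _ hν _ _ hab _ _ hsol hmean hR t ht =>
    ⟨h₁ hd hν hab hsol hmean hR.1 t ht, h₂ hd hν hab hsol hmean hR.2 t ht⟩

/-! ## Positive control: energy sublevel sets -/

/-- Along a classical solution of the unforced system on `[a, b]` the kinetic energy is
non-increasing: `K(u t) ≤ K(u a)` (energy balance `dK/dt = −ν‖∇u‖₂² ≤ 0`,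
`Torus.IsClassicalNSSolutionOn.energy_balance_holds`, and a function with non-positive
one-sided derivative on an interval is antitone). [folklore] -/
theorem kineticEnergy_le_initial {ν a b : ℝ} (hν : 0 ≤ ν)
    {u : ℝ → UnitAddTorus d → EuclideanSpace ℝ d} {p : ℝ → UnitAddTorus d → ℝ}
    (hsol : Torus.IsClassicalNSSolutionOn (Icc a b) ν 0 u p) {t : ℝ} (ht : t ∈ Icc a b) :
    Torus.kineticEnergy (u t) ≤ Torus.kineticEnergy (u a) := by
  have hK : ∀ s ∈ Icc a b, HasDerivWithinAt (fun r => Torus.kineticEnergy (u r))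
      (-ν * Torus.gradNormSq (u s)) (Icc a b) s := by
    intro s hs
    have hb := Torus.IsClassicalNSSolutionOn.energy_balance_holds hsol (convex_Icc a b) hs
    simpa using hb
  have hanti : AntitoneOn (fun r => Torus.kineticEnergy (u r)) (Icc a b) := by
    refine antitoneOn_of_hasDerivWithinAt_nonpos (convex_Icc a b)
      (fun s hs => (hK s hs).continuousWithinAt)
      (fun s hs => (hK s (interior_subset hs)).mono interior_subset) fun s hs => ?_
    have := Torus.gradNormSq_nonneg (u s)
    nlinarith
  exact hanti (left_mem_Icc.2 (ht.1.trans ht.2)) ht ht.1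

/-- **Positive control: energy sublevel sets are invariant regions.** For every level `c`,
`{v : K(v) ≤ c}` is forward-invariant along zero-mean classical solutions of unforced
Navier–Stokes on `T³`. [folklore] -/
theorem kineticEnergy_sublevel_isInvariantRegion (c : ℝ) :
    IsInvariantRegion (d := d) (fun _ v => Torus.kineticEnergy v ≤ c) :=
  fun _ _ hν _ _ _ _ _ hsol _ hR _ ht => (kineticEnergy_le_initial hν.le hsol ht).trans hR

/-! ## Degenerate slices: zero enstrophy means rest -/

/-- A smooth zero-mean field with zero enstrophy vanishes (Poincaré on the unit torus,
`4π²∫‖v‖² ≤ ‖∇v‖₂² = 2ℰ(v)`). [folklore] -/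
theorem eq_zero_of_torusEnstrophy_eq_zero {v : UnitAddTorus d → EuclideanSpace ℝ d}
    (hv : Torus.IsSmooth v) (h0 : Torus.HasZeroMean v) (hE : torusEnstrophy v = 0) : v = 0 := by
  have hP := Torus.integral_norm_sq_le_gradNormSq_of_hasZeroMean hv h0
  rw [gradNormSq_eq_two_mul_torusEnstrophy, hE, mul_zero] at hP
  refine Torus.eq_zero_of_integral_norm_sq_nonpos hv ?_
  have hπ : 0 < 4 * Real.pi ^ 2 := by positivity
  by_contra hneg
  have : 0 < 4 * Real.pi ^ 2 * ∫ x, ‖v x‖ ^ 2 := mul_pos hπ (not_le.mp hneg)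
  linarith

/-- The rest state has zero enstrophy. [folklore] -/
theorem torusEnstrophy_zero : torusEnstrophy (0 : UnitAddTorus d → EuclideanSpace ℝ d) = 0 := by
  simp [torusEnstrophy, Torus.gradNormSq, Torus.partialDeriv, Torus.lineDeriv]

/-- **Once at rest, always at rest**: if a classical solution of the unforced system on `[a, b]`
vanishes at a time `s`, it vanishes at every later time of the window (forward uniqueness,
`Torus.IsClassicalNSSolutionOn.velocity_unique_of_mem`, against the steady rest state
`isClassicalNSSolutionOn_const ν 0`). [folklore] -/
theorem velocity_eq_zero_of_eq_zero {ν a b : ℝ} (hν : 0 ≤ ν) (hab : a < b)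
    {u : ℝ → UnitAddTorus d → EuclideanSpace ℝ d} {p : ℝ → UnitAddTorus d → ℝ}
    (hsol : Torus.IsClassicalNSSolutionOn (Icc a b) ν 0 u p) {s t : ℝ} (hs : s ∈ Icc a b)
    (ht : t ∈ Icc a b) (hst : s ≤ t) (h0 : u s = 0) : u t = 0 := by
  have hrest : Torus.IsClassicalNSSolutionOn (Icc a b) ν 0
      (fun (_ : ℝ) (_ : UnitAddTorus d) => (0 : EuclideanSpace ℝ d)) 0 :=
    (isClassicalNSSolutionOn_const ν (0 : EuclideanSpace ℝ d)).mono (subset_univ _)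
      (uniqueDiffOn_Icc hab)
  have h := hsol.velocity_unique_of_mem hν (convex_Icc a b) hrest hs (by rw [h0]; rfl) ht hst
  rw [h]
  rfl

/-! ## The Lu–Doering small-data region -/

/-- **The Lu–Doering small-data region is forward-invariant (conditional on the Lu–Doering
estimate).** Under the tree's named fact `LuDoering2008_enstrophyRate_le`
(`dℰ/dt ≤ 27/(8π⁴ν³) ℰ³` on the unit 3-torus), the region
`{v : (C_LD(ν)/(2ν)) K(v) ℰ(v) < 1}` — i.e. `27 K ℰ < (2πν)⁴` (`luDoeringConst_div_two_nu`;
Ayala–Protas 2017, (2.11)–(2.12), after Lu–Doering 2008) — is an invariant region: along every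
zero-mean classical solution of unforced Navier–Stokes on `T³ × [a, b]`, if it holds at `t = a`
it holds at every `t ∈ [a, b]`. While `ℰ > 0` this is the monotonicity of `1/ℰ − cK`
(`inv_torusEnstrophy_sub_inv_le`); a slice with `ℰ = 0` is the rest state and stays so.
CONDITIONAL result: the hypothesis `hLD` is an undischarged named fact. [folklore] -/
theorem luDoering_smallData_isInvariantRegion (hLD : LuDoering2008_enstrophyRate_le (d := d)) :
    IsInvariantRegion (d := d) (fun ν v =>
      luDoeringConst ν / (2 * ν) * Torus.kineticEnergy v * torusEnstrophy v < 1) := by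
  intro hd ν hν a b hab u p hsol hmean hRa t ht
  set c : ℝ := luDoeringConst ν / (2 * ν) with hc
  by_cases hpos : ∀ s ∈ Icc a t, 0 < torusEnstrophy (u s)
  · -- positive enstrophy on `[a, t]`: use the monotonicity of `1/ℰ − cK`
    rcases eq_or_lt_of_le ht.1 with hta | hat
    · rw [← hta]; exact hRa
    have hsub : Icc a t ⊆ Icc a b := Icc_subset_Icc_right ht.2
    have hsol' := hsol.mono hsub (uniqueDiffOn_Icc hat)
    have hmean' : ∀ s ∈ Icc a t, Torus.HasZeroMean (u s) := fun s hs => hmean s (hsub hs)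
    have hineq := inv_torusEnstrophy_sub_inv_le hLD hd hν hat hsol' hmean' hpos
      (right_mem_Icc.2 hat.le)
    have hEa : 0 < torusEnstrophy (u a) := hpos a (left_mem_Icc.2 hat.le)
    have hEt : 0 < torusEnstrophy (u t) := hpos t (right_mem_Icc.2 hat.le)
    have h1 : c * Torus.kineticEnergy (u a) < (torusEnstrophy (u a))⁻¹ := by
      rw [inv_eq_one_div]
      exact (lt_div_iff₀ hEa).mpr hRa
    have h3 : c * Torus.kineticEnergy (u t) < (torusEnstrophy (u t))⁻¹ := by linarith
    rw [inv_eq_one_div] at h3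
    exact (lt_div_iff₀ hEt).mp h3
  · -- some slice on `[a, t]` has zero enstrophy: the solution is at rest from then on
    simp only [not_forall, not_lt] at hpos
    obtain ⟨s, hs, hEs⟩ := hpos
    have hsb : s ∈ Icc a b := ⟨hs.1, hs.2.trans ht.2⟩
    have hE0 : torusEnstrophy (u s) = 0 := le_antisymm hEs (torusEnstrophy_nonneg _)
    have hus : u s = 0 :=
      eq_zero_of_torusEnstrophy_eq_zero (hsol.smooth_velocity.isSmooth_slice hsb) (hmean s hsb) hE0
    have hut : u t = 0 := velocity_eq_zero_of_eq_zero hν.le hab hsol hsb ht hs.2 hus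
    rw [hut, torusEnstrophy_zero, mul_zero]
    exact zero_lt_one

end Summit.NavierStokesRegularity.FunctionalMining

end
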